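import Summits.Ventures.DiscreteObjects.PP12.FanoFiveSignSystem

/-!
# PP(12), order 5: balance, the `{2,2,1,1}` profile of `R`, and the Gram identities `EᵀE = 24I − 2MMᵀ`, `E*ᵀE* = 24I − 2MᵀM` from a typed orbit matrix (kernel)
Framing: lottery ticket; floor = certified bounds/negative ranges.

Cell pub-namedobj (venture DiscreteObjects), target (M), designs gen 17 (p = 5 identification, designs g16 HANDOFF item (c)); continues
`FanoFiveSignSystem`. For `IsFanoFiveIncMatrix I M` with `FanoFive.IsIncidence I` and the read-off signs `sgnM / eps / epsStar / rr`:
* balance: `Σ_O ε_x(O) = 0`, `Σ_N ε*_μ(N) = 0` (each of the two line orbits at `x` carries `8` of the `16` exterior point orbits; dually);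
* `R`: row sums `6`, row square sums `10`, the same for columns, hence exactly two `2`s and two `1`s in every row and column (`profile_of_sums`);
* `EᵀE = 24I − 2MMᵀ` (`gram_eps`) and `E*ᵀE* = 24I − 2MᵀM` (`gram_epsStar`): expand `Σ_c (M (x,0) c − M (x,1) c)(M (y,0) c − M (y,1) c)` once by
  bilinearity into four complete row inner products (`= 12, 0, 5` by the plain system) and once over tangent / exterior columns (the tangent
  `2 × 2` blocks contribute `2 sgnM x μ · sgnM y μ` each) — designs g10 FAMILY-P5PLANE §2 (c) obtained the same identity by a geometric pair count;
  here it is pure bookkeeping on the typed statement.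
Nothing here asserts any census statement. No `sorry`, no new axioms.
-/

namespace Summit.Ventures.DiscreteObjects.PP12

open Finset

namespace FanoFive

/-- bilinear expansion of a sum of products of differences -/
theorem sum_sub_mul_sub {ι : Type*} [Fintype ι] (a0 a1 b0 b1 : ι → ℤ) :
    ∑ i, (a0 i - a1 i) * (b0 i - b1 i) = ∑ i, a0 i * b0 i - ∑ i, a0 i * b1 i - ∑ i, a1 i * b0 i + ∑ i, a1 i * b1 i := by
  simp only [sub_mul, mul_sub, Finset.sum_sub_distrib]
  ring

/-- a difference times a third function, expanded -/
theorem sum_sub_mul {ι : Type*} [Fintype ι] (a0 a1 b : ι → ℤ) :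
    ∑ i, (a0 i - a1 i) * b i = ∑ i, a0 i * b i - ∑ i, a1 i * b i := by
  simp only [sub_mul, Finset.sum_sub_distrib]

/-- **counting lemma:** a `{0,1,2}`-valued function on `Fin 16` with sum `6` and square sum `10` takes the value `2` exactly twice and the value
`1` exactly twice. -/
theorem profile_of_sums (f : Fin 16 → ℤ) (h0 : ∀ i, f i = 0 ∨ f i = 1 ∨ f i = 2) (h1 : ∑ i, f i = 6) (h2 : ∑ i, f i * f i = 10) :
    (univ.filter fun i => f i = 2).card = 2 ∧ (univ.filter fun i => f i = 1).card = 2 := by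
  have e1 : ∑ i, f i = ∑ i, ((if f i = 1 then 1 else 0 : ℤ) + 2 * (if f i = 2 then 1 else 0 : ℤ)) := by
    refine Finset.sum_congr rfl fun i _ => ?_
    rcases h0 i with h | h | h <;> simp [h]
  have e2 : ∑ i, f i * f i = ∑ i, ((if f i = 1 then 1 else 0 : ℤ) + 4 * (if f i = 2 then 1 else 0 : ℤ)) := by
    refine Finset.sum_congr rfl fun i _ => ?_
    rcases h0 i with h | h | h <;> simp [h]
  rw [Finset.sum_add_distrib, ← Finset.mul_sum, Finset.sum_boole, Finset.sum_boole] at e1 e2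
  constructor <;> omega

end FanoFive

namespace IsFanoFiveIncMatrix

open FanoFive

variable {I : Fin 7 → Fin 7 → Bool} {M : F5Idx → F5Idx → ℕ}

/-- a tangent column has exactly `4` ones in the tangent rows (one line orbit at each fixed point off its fixed line) … -/
theorem tangent_col_tangent_sum (hI : FanoFive.IsIncidence I) (h : IsFanoFiveIncMatrix I M) (μ : Fin 7) (b : Fin 2) :
    ∑ x : Fin 7, ∑ a : Fin 2, M (Sum.inl (x, a)) (Sum.inl (μ, b)) = 4 := by
  simp_rw [h.2.2.2.1 μ b]
  rw [Finset.sum_ite, Finset.sum_const_zero, zero_add, Finset.sum_const, smul_eq_mul, mul_one]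
  have h3 := hI.2.1 μ
  have htot : (univ.filter fun x : Fin 7 => I x μ = true).card + (univ.filter fun x : Fin 7 => ¬ I x μ = true).card = 7 := by
    rw [Finset.card_filter_add_card_filter_not]; simp
  have : (univ.filter fun x : Fin 7 => ¬ I x μ = true) = univ.filter fun x : Fin 7 => ¬ I x μ := by simp
  omega

/-- … and hence `8` exterior line orbits through it (`12 − 4`). -/
theorem tangent_col_exterior_sum (hI : FanoFive.IsIncidence I) (h : IsFanoFiveIncMatrix I M) (μ : Fin 7) (b : Fin 2) :
    ∑ N : Fin 16, M (Sum.inr N) (Sum.inl (μ, b)) = 8 := by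
  have htot := h.1.2.1 (Sum.inl (μ, b))
  rw [Fintype.sum_sum_type, Fintype.sum_prod_type] at htot
  have h4 := tangent_col_tangent_sum hI h μ b
  simp only [FanoFive.total] at htot
  omega

/-- **balance of `E`:** `Σ_O ε_x(O) = 0` -/
theorem eps_balanced (hI : FanoFive.IsIncidence I) (h : IsFanoFiveIncMatrix I M) (x : Fin 7) : ∑ O : Fin 16, eps M O x = 0 := by
  unfold eps
  rw [Finset.sum_sub_distrib]
  have h0 := tangent_row_exterior_sum hI h x 0
  have h1 := tangent_row_exterior_sum hI h x 1
  have h0' : ∑ O : Fin 16, (M (Sum.inl (x, 0)) (Sum.inr O) : ℤ) = 8 := by exact_mod_cast h0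
  have h1' : ∑ O : Fin 16, (M (Sum.inl (x, 1)) (Sum.inr O) : ℤ) = 8 := by exact_mod_cast h1
  rw [h0', h1']; norm_num

/-- **balance of `E*`:** `Σ_N ε*_μ(N) = 0` -/
theorem epsStar_balanced (hI : FanoFive.IsIncidence I) (h : IsFanoFiveIncMatrix I M) (μ : Fin 7) : ∑ N : Fin 16, epsStar M N μ = 0 := by
  unfold epsStar
  rw [Finset.sum_sub_distrib]
  have h0 := tangent_col_exterior_sum hI h μ 0
  have h1 := tangent_col_exterior_sum hI h μ 1
  have h0' : ∑ N : Fin 16, (M (Sum.inr N) (Sum.inl (μ, 0)) : ℤ) = 8 := by exact_mod_cast h0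
  have h1' : ∑ N : Fin 16, (M (Sum.inr N) (Sum.inl (μ, 1)) : ℤ) = 8 := by exact_mod_cast h1
  rw [h0', h1']; norm_num

/-- the tangent part of an exterior column total is `7` (one tangent line orbit at each fixed point) -/
theorem exterior_col_tangent_sum (h : IsFanoFiveIncMatrix I M) (O : Fin 16) :
    ∑ x : Fin 7, ∑ a : Fin 2, M (Sum.inl (x, a)) (Sum.inr O) = 7 := by
  simp_rw [h.2.2.2.2 O]
  simp

/-- the tangent part of an exterior column NORM is `7` as well (the entries are `0/1`) -/
theorem exterior_col_tangent_sq (h : IsFanoFiveIncMatrix I M) (O : Fin 16) :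
    ∑ x : Fin 7, ∑ a : Fin 2, M (Sum.inl (x, a)) (Sum.inr O) * M (Sum.inl (x, a)) (Sum.inr O) = 7 := by
  have e : ∀ x a, M (Sum.inl (x, a)) (Sum.inr O) * M (Sum.inl (x, a)) (Sum.inr O) = M (Sum.inl (x, a)) (Sum.inr O) := by
    intro x a
    have h1 := IsFanoFiveOrbitMatrix.entry_le_one_of_tangent_row h.1 (x, a) (Sum.inr O)
    interval_cases M (Sum.inl (x, a)) (Sum.inr O) <;> rfl
  simp_rw [e]
  exact exterior_col_tangent_sum h O

/-- the tangent part of an exterior row total is `7` (one tangent point orbit on each fixed line) -/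
theorem exterior_row_tangent_sum (h : IsFanoFiveIncMatrix I M) (N : Fin 16) :
    ∑ μ : Fin 7, ∑ b : Fin 2, M (Sum.inr N) (Sum.inl (μ, b)) = 7 := by
  simp_rw [h.2.2.1 N]
  simp

/-- the tangent part of an exterior row NORM is `7` as well -/
theorem exterior_row_tangent_sq (h : IsFanoFiveIncMatrix I M) (N : Fin 16) :
    ∑ μ : Fin 7, ∑ b : Fin 2, M (Sum.inr N) (Sum.inl (μ, b)) * M (Sum.inr N) (Sum.inl (μ, b)) = 7 := by
  have e : ∀ μ b, M (Sum.inr N) (Sum.inl (μ, b)) * M (Sum.inr N) (Sum.inl (μ, b)) = M (Sum.inr N) (Sum.inl (μ, b)) := by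
    intro μ b
    have h1 := IsFanoFiveOrbitMatrix.entry_le_one_of_tangent_col h.1 (Sum.inr N) (μ, b)
    interval_cases M (Sum.inr N) (Sum.inl (μ, b)) <;> rfl
  simp_rw [e]
  exact exterior_row_tangent_sum h N

/-- **rows of `R` sum to `6`** (six exterior lines through an exterior point) -/
theorem rr_row_sum (h : IsFanoFiveIncMatrix I M) (O : Fin 16) : ∑ N : Fin 16, rr M O N = 6 := by
  have htot := h.1.2.1 (Sum.inr O)
  rw [Fintype.sum_sum_type, Fintype.sum_prod_type, exterior_col_tangent_sum h O] at htot
  simp only [FanoFive.total] at htot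
  unfold rr
  have : ∑ N : Fin 16, M (Sum.inr N) (Sum.inr O) = 6 := by omega
  exact_mod_cast this

/-- **rows of `R` have square sum `10`** -/
theorem rr_row_sq (h : IsFanoFiveIncMatrix I M) (O : Fin 16) : ∑ N : Fin 16, rr M O N * rr M O N = 10 := by
  have hn := h.1.2.2.2 (Sum.inr O) (Sum.inr O)
  rw [Fintype.sum_sum_type, Fintype.sum_prod_type, exterior_col_tangent_sq h O] at hn
  simp only [FanoFive.target, if_true] at hn
  unfold rr
  have : ∑ N : Fin 16, M (Sum.inr N) (Sum.inr O) * M (Sum.inr N) (Sum.inr O) = 10 := by omega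
  exact_mod_cast this

/-- **columns of `R` sum to `6`** (six exterior points on an exterior line) -/
theorem rr_col_sum (h : IsFanoFiveIncMatrix I M) (N : Fin 16) : ∑ O : Fin 16, rr M O N = 6 := by
  unfold rr
  exact_mod_cast exterior_row_exterior_sum h N

/-- **columns of `R` have square sum `10`** -/
theorem rr_col_sq (h : IsFanoFiveIncMatrix I M) (N : Fin 16) : ∑ O : Fin 16, rr M O N * rr M O N = 10 := by
  have hn := h.1.2.2.1 (Sum.inr N) (Sum.inr N)
  rw [Fintype.sum_sum_type, Fintype.sum_prod_type, exterior_row_tangent_sq h N] at hn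
  simp only [FanoFive.target, if_true] at hn
  unfold rr
  have : ∑ O : Fin 16, M (Sum.inr N) (Sum.inr O) * M (Sum.inr N) (Sum.inr O) = 10 := by omega
  exact_mod_cast this

/-- **every row of `R` has exactly two `2`s and two `1`s** -/
theorem rr_row_profile (h : IsFanoFiveIncMatrix I M) (O : Fin 16) :
    (univ.filter fun N => rr M O N = 2).card = 2 ∧ (univ.filter fun N => rr M O N = 1).card = 2 :=
  profile_of_sums (fun N => rr M O N) (fun N => rr_range h O N) (rr_row_sum h O) (rr_row_sq h O)

/-- **every column of `R` has exactly two `2`s and two `1`s** -/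
theorem rr_col_profile (h : IsFanoFiveIncMatrix I M) (N : Fin 16) :
    (univ.filter fun O => rr M O N = 2).card = 2 ∧ (univ.filter fun O => rr M O N = 1).card = 2 :=
  profile_of_sums (fun O => rr M O N) (fun O => rr_range h O N) (rr_col_sum h N) (rr_col_sq h N)

/-- a complete row inner product of the plain system, cast to `ℤ` -/
theorem row_inner_cast (h : IsFanoFiveIncMatrix I M) (r r' : F5Idx) :
    ∑ c : F5Idx, (M r c : ℤ) * (M r' c : ℤ) = (FanoFive.target r r' : ℤ) := by
  rw [← h.1.2.2.1 r r']; push_cast; rfl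

/-- a complete column inner product of the plain system, cast to `ℤ` -/
theorem col_inner_cast (h : IsFanoFiveIncMatrix I M) (c c' : F5Idx) :
    ∑ r : F5Idx, (M r c : ℤ) * (M r c' : ℤ) = (FanoFive.target c c' : ℤ) := by
  rw [← h.1.2.2.2 c c']; push_cast; rfl

/-- the signed combination of the four targets of two tangent pairs: `24` on the diagonal, `0` off it -/
theorem target_signed_comb (x y : Fin 7) :
    (FanoFive.target (Sum.inl (x, 0)) (Sum.inl (y, 0)) : ℤ) - (FanoFive.target (Sum.inl (x, 0)) (Sum.inl (y, 1)) : ℤ)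
      - (FanoFive.target (Sum.inl (x, 1)) (Sum.inl (y, 0)) : ℤ) + (FanoFive.target (Sum.inl (x, 1)) (Sum.inl (y, 1)) : ℤ)
      = if x = y then 24 else 0 := by
  by_cases hxy : x = y
  · subst hxy; simp [FanoFive.target]
  · simp [FanoFive.target, hxy]

/-- **`EᵀE = 24 I − 2 M Mᵀ`:** `Σ_O ε_x(O) ε_y(O) = 24·[x = y] − 2 Σ_μ sgnM x μ · sgnM y μ` -/
theorem gram_eps (h : IsFanoFiveIncMatrix I M) (x y : Fin 7) :
    ∑ O : Fin 16, eps M O x * eps M O y = (if x = y then 24 else 0) - 2 * ∑ μ : Fin 7, sgnM M x μ * sgnM M y μ := by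
  -- the signed row-difference product, summed over ALL columns
  set F : F5Idx → ℤ := fun c => ((M (Sum.inl (x, 0)) c : ℤ) - (M (Sum.inl (x, 1)) c : ℤ)) *
    ((M (Sum.inl (y, 0)) c : ℤ) - (M (Sum.inl (y, 1)) c : ℤ)) with hF
  have total : ∑ c, F c = if x = y then 24 else 0 := by
    simp only [hF]
    rw [sum_sub_mul_sub, row_inner_cast h, row_inner_cast h, row_inner_cast h, row_inner_cast h]
    exact target_signed_comb x y
  have split : ∑ c, F c = 2 * ∑ μ : Fin 7, sgnM M x μ * sgnM M y μ + ∑ O : Fin 16, eps M O x * eps M O y := by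
    rw [Fintype.sum_sum_type, Fintype.sum_prod_type]
    simp only [hF]
    congr 1
    · rw [Finset.mul_sum]
      exact Finset.sum_congr rfl fun μ _ => sum_rowdiff_mul_rowdiff h x y μ
  rw [split] at total
  linarith

/-- the signed combination of the four targets of two tangent column pairs -/
theorem target_signed_comb_col (μ ν : Fin 7) :
    (FanoFive.target (Sum.inl (μ, 0)) (Sum.inl (ν, 0)) : ℤ) - (FanoFive.target (Sum.inl (μ, 0)) (Sum.inl (ν, 1)) : ℤ)
      - (FanoFive.target (Sum.inl (μ, 1)) (Sum.inl (ν, 0)) : ℤ) + (FanoFive.target (Sum.inl (μ, 1)) (Sum.inl (ν, 1)) : ℤ)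
      = if μ = ν then 24 else 0 :=
  target_signed_comb μ ν

/-- **`E*ᵀE* = 24 I − 2 Mᵀ M`:** `Σ_N ε*_μ(N) ε*_ν(N) = 24·[μ = ν] − 2 Σ_x sgnM x μ · sgnM x ν` -/
theorem gram_epsStar (h : IsFanoFiveIncMatrix I M) (μ ν : Fin 7) :
    ∑ N : Fin 16, epsStar M N μ * epsStar M N ν = (if μ = ν then 24 else 0) - 2 * ∑ x : Fin 7, sgnM M x μ * sgnM M x ν := by
  set G : F5Idx → ℤ := fun r => ((M r (Sum.inl (μ, 0)) : ℤ) - (M r (Sum.inl (μ, 1)) : ℤ)) *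
    ((M r (Sum.inl (ν, 0)) : ℤ) - (M r (Sum.inl (ν, 1)) : ℤ)) with hG
  have total : ∑ r, G r = if μ = ν then 24 else 0 := by
    simp only [hG]
    rw [sum_sub_mul_sub, col_inner_cast h, col_inner_cast h, col_inner_cast h, col_inner_cast h]
    exact target_signed_comb_col μ ν
  have split : ∑ r, G r = 2 * ∑ x : Fin 7, sgnM M x μ * sgnM M x ν + ∑ N : Fin 16, epsStar M N μ * epsStar M N ν := by
    rw [Fintype.sum_sum_type, Fintype.sum_prod_type]
    simp only [hG]
    congr 1
    · rw [Finset.mul_sum]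
      exact Finset.sum_congr rfl fun x _ => sum_coldiff_mul_coldiff h x μ ν
  rw [split] at total
  linarith

end IsFanoFiveIncMatrix

end Summit.Ventures.DiscreteObjects.PP12
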